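import Summits.QuantumFields.YangMills.Theses.ParabolicTrajectory
import Summits.QuantumFields.YangMills.Theorems.ParabolicTrajectoryLatticeGapOnTrajectoryDefs
import Summits.QuantumFields.YangMills.Theorems.ParabolicTrajectoryLatticeGapOnTrajectoryStubWilsonTorusDLR
import Summits.QuantumFields.YangMills.Theorems.ParabolicTrajectoryLatticeGapOnTrajectoryStubSpecificationTower
import Summits.QuantumFields.YangMills.Theorems.ParabolicTrajectoryLatticeGapOnTrajectoryStubKRFiniteSizeDecay
import Summits.QuantumFields.YangMills.Theorems.ParabolicTrajectoryLatticeGapOnTrajectoryStubTorusFrames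
import Summits.QuantumFields.YangMills.Theorems.ParabolicTrajectoryLatticeGapOnTrajectoryStubSmoothingToGap
import Summits.QuantumFields.YangMills.Theorems.ParabolicTrajectoryLatticeGapOnTrajectoryTransferFromOSGap

/-!
# Line `orbit-kantorovich-finite-size` — skeleton for crux `ParabolicTrajectory.LatticeGapOnTrajectory`
(stmt-QuantumFields-10523, conjunct (B) of route ParabolicTrajectory rev 4), crux-plan round 1.

**Idea (Cruxes/LatticeGapOnTrajectory/Ideas/orbit-kantorovich-finite-size.md; triage r1-1/2/3: pass).**
Weak coupling is LOW temperature for the link variables but the physical cell is CRITICAL-HARMONIC for orbits: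
read Wilson's torus measure at `β_k` as a specification on CELLS of side `b_k = t·M^{n_k}` lattice units
(`t` crux units), measure boundary data in the capped gauge-ORBIT transport weight
`w_c(U, U') = min(1, inf_g sup_{e ∈ c} d_r(U_e, (U'^g)_e)/α)` (`g` over gauge transformations at the
cell's interior sites), and ask for Dobrushin–Shlosman's finite-size condition in KANTOROVICH form at ONE
window shape `(2n₀+1)⁴` cells, eventually in `k`, with `k`-uniform `(n₀, γ₀ < 1)` — `stub_orbitKantorovichWindow`
(THE PHYSICS, open, hardest: marginal exactly at tree level, failed exactly by an `Ad`-invariant direction of `𝔤`).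
The engine `stub_krFiniteSizeDecay` (DS85 in the dual-Lipschitz = Dobrushin-1970/Föllmer form, on a finite 4-d
torus of cells, no translation invariance: "received" sum condition) turns the window condition into covariance
decay `C₀ (Σδ_f)(Σδ_g) e^{-κ D}` for cell-Lipschitz observables under ANY Gibbs measure of the cell specification,
with `(κ, C₀)` depending on `(n₀, γ₀, R)` only; run on the SYMMETRIC torus `(2S+1)⁴` itself (a finite site set)
it needs no transfer matrix and no thermal-trace control — `S`-uniformity is automatic (card (iv)).
`stub_wilsonTorusDLR` (Wilson's torus measure is a Gibbs measure of the torus Wilson specification) feeds it the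
crux's measure; `stub_smoothingToGap` (tower property `cov(A,B) = cov(γ_W A, γ_W B)` + frames adapted to the
supports + geometry) reaches the crux's `HasLatticeMassGap` for ALL bounded measurable species through the second,
`G`-blind physics clause `RoughCentreBound` (UV decoupling: the shell moves lattice-local links at the window
centre by `a_k²ε ≪ g_k`); `stub_transfer` is the transfer half (Disproof PROVER NOTE, weakened to "∃ rate").

Stubs (sorried, registered): `stub_krFiniteSizeDecay`, `stub_wilsonTorusDLR`, `stub_orbitKantorovichWindow`,
`stub_torusFrames`, `stub_specificationTower` (lead reshape 1), `stub_smoothingToGap`, `stub_transfer`. Composition (no hypotheses, concludes the crux BY NAME, sorry only inside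
the stubs it calls): `LatticeGapOnTrajectory_of`.

Disproof.lean (v3.7, RESISTS) used: §2 `concl_iff_split` — the two halves are produced at INDEPENDENT rates and
glued by `min` (`hasLatticeMassGap_anti`, `osData_hasMassGap_anti` re-proved below verbatim); §5 `WithoutSimple`
honoured AT `stub_orbitKantorovichWindow` (an `Ad G`-invariant direction of `𝔤`, e.g. the `u(1)` of `SU(2)×U(1)`,
transmits the constant-curvature boundary mode undiminished, `Σk ≥ |W|(1-o(1))`, so the window condition fails —
the line uses `IsCompactSimpleLieGroup` exactly there and in `stub_transfer`; the engine, DLR and smoothing stubs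
are `G`-blind and hold for photons); `WithoutBeta`/`WithoutTuning` enter the same stub (no `k`-uniform cell
exists without the tuning; at a finite-β first-order point two phases violate any DS condition); §1
`two_le_of_shape` (`2 ≤ M` is decoration — carried, unused); §6(i) no θ-uniform rate (here `Δ ≍ κ/t(θ)`,
`t(θ) ≍ e^{c/√θ}` on the UV branch); §6(ii) no observable-uniform constant (`C = C₀K_s²‖A‖‖B‖e^{…}`); PROVER
NOTE on the transfer half (thermal traces on odd tori) — the lattice half here never meets a thermal trace, the
transfer stub inherits the note's route and its caveat (line card §Transfer). Landed Negative lemmas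
(`Negative/ZeroCoupling*`, `Negative/BlowUp`): `β ≡ 0` has every gap and empties the tuning — consistent
(`stub_smoothingToGap` does not use `β_k → ∞`; only the physics stub does).
-/

/-! ## Integration status (lead, cycle 1, reshape 3)
Vocabulary: `Theorems/ParabolicTrajectoryLatticeGapOnTrajectoryDefs.lean` (p79110). LANDED stubs (imported, sorry removed):
`stub_wilsonTorusDLR` (p95462), `stub_specificationTower` (p95464), `stub_krFiniteSizeDecay` (p95465; engine layers in
Literature `DobrushinShlosman*` p76806/p77133/p77379/p77502), `stub_torusFrames` (walk p95490 + main), `stub_smoothingToGap`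
(helpers p95467 + main). OPEN: `stub_orbitKantorovichWindow` (the physics; reshape 2 = drefute R1, k-dependent resolution).
STUCK AS TYPED: `stub_transfer` — mis-stated at crux level (evidence transfer-analysis.md); its REPAIRED form is proved in the tree:
`Transfer.transferHalf_of_torusOSGap` (…TransferFromOSGap.lean p95381: `TorusOSGap r sch Δ` + reflection-symmetric `sch'` ⇒
`T.HasMassGap Δ`) — an idealisation (no thermal slack; see item evidence restatement-C-prime-v2.md) — and its honest form
`Transfer.transferHalf_of_torusOSGapSlack` (…TransferFromOSGapSlack.lean p96292: `TorusOSGapSlack r sch Δ ε` with `ε` a_k-superpolynomially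
small + reflection-symmetric, polynomially bounded `sch'` ⇒ `T.HasMassGap Δ`); neither can replace the registered stub because the crux quantifies
over ALL `sch'` and states the lattice half only in sup-norm form. -/

set_option autoImplicit false

noncomputable section

namespace Summit.QuantumFields.YangMills.Cruxes.LatticeGapOnTrajectory.OrbitKantorovichFiniteSize

open scoped BigOperators Topology ENNReal ProbabilityTheory
open Filter MeasureTheory
open Literature.Probability.LatticeModels (Specification IsSpecification IsGibbsMeasure glueWith)
open Literature.MathematicalPhysics.QuantumFieldTheory
open Summit.QuantumFields.YangMills.Theses.ParabolicTrajectory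

/-! ## §3 The registered stubs still open -/

/-- **stub_orbitKantorovichWindow** — THE PHYSICS (open; hardest; the line's bet; the only stub using
`IsCompactSimpleLieGroup`, `β_k → ∞` and the tuning — Disproof §5 `WithoutSimple/WithoutBeta/WithoutTuning` are
honoured HERE). Along every M-adic tuned Wilson scheme there are `t, n₀, γ₀ < 1, α, K_s` with
`OrbitKRWindowsAlong`: (W) the orbit–Kantorovich window condition — at tree level the influence of the boundary cell
`y` on the interior cell `x` is the cell-scale harmonic measure, `Σ_yΣ_x k = |W|` EXACTLY for the massless Gaussian
(marginal: no false positive; an `Ad G`-invariant direction of `𝔤` transmits the constant-curvature mode and keeps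
it `≥ |W|(1−o(1))` at every scale — photons, `SU(2)×U(1)`), while a mass `m` gives `Σ_yΣ_x k ≈ |∂W|(1+1/(mb)) ≤ γ₀|W|`
once `b ≳ 1/m`, `2n₀+1 ≳ 8(1+1/(mb))/γ₀` (triage r1-1/r1-3 recomputation); the claim is that the interacting
theory at `b = t·D_k ≫ ξ_k` sits on the massive side, `k`-uniformly, for every frame of scale in `[b,2b]`
(the cell must exceed the confinement length: `t(θ) ≍ e^{c/√θ}` on the UV branch, Disproof §6(i)); large fields are
NOT assumed absent (triage r1-1 (b): `~e^{(10.8−c)β}` fixed-threshold large plaquettes per cell) — the sup over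
boundary data includes rough data and the transport must SYNCHRONISE them; boundary-pinned defects are the
refuter's target (r1-2 retracted one attempt). (R) the rough-centre bound (UV decoupling, holds even for photons).
Why it might be false: a weak-coupling massless phase for some compact simple `G` (the crux itself), or strong
mixing failing while the vacuum gap holds (Martinelli–Olivieri: boundary-pinned rigid defects — expected only for
FINITE gauge groups). Perturbatively invisible (Σk ≳ |W| to all orders). Sources: DobrushinShlosman1985,
Balaban1988Convergent, Balaban1989LargeFieldII, OsterwalderSeiler1978, Guth1980, arXiv:hep-lat/0204023 (complete
screening of a constant abelian chromomagnetic background at `T = 0`), Luscher1986, MartinelliOlivieri1994. -/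
theorem stub_orbitKantorovichWindow :
    ∀ (G : Type) [Group G] [TopologicalSpace G] [IsTopologicalGroup G] [CompactSpace G]
      [MeasurableSpace G] [BorelSpace G], IsCompactSimpleLieGroup G →
      ∀ (r : LatticeRep G) (M : ℕ) (θ : ℝ) (sch : SpeciesScheme (YMSpecies G)) (n : ℕ → ℕ),
        2 ≤ M → 0 < θ → (∀ k, sch.a k = ((M : ℝ) ^ n k)⁻¹) → Tendsto sch.β atTop atTop →
        Tendsto (fun k => ((M : ℝ) ^ n k) ^ 8 *
            latticeConnectedCorr r.ρ (sch.β k) (sch.side k) r.curvature.F r.curvature.F (M ^ n k))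
          atTop (𝓝 θ) →
        OrbitKRWindowsAlong r M sch n := by
  sorry

/-- **stub_transfer** — THE TRANSFER HALF (shared by every line of this crux). LEAD VERDICT (cycle 1): MIS-STATED AT CRUX
LEVEL — from the per-pair sup-norm `HasLatticeMassGap` and arbitrary witness renormalisations `sch'` no proof is known (item
evidence transfer-analysis.md); the REPAIRED form is PROVED in the tree: `Transfer.transferHalf_of_torusOSGap`
(`…TransferFromOSGap.lean`: `TorusOSGap r sch Δ` + `sch'.IsReflectionSymmetric` ⇒ `T.HasMassGap Δ`). Kept registered verbatim
so the composition below still type-checks against the crux AS FILED. Original plan (size L; the route of the Disproof's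
PROVER NOTE, asked here in a WEAKER form: all crux hypotheses + the lattice half ⇒ SOME positive continuum rate).
For `T` with `IsYangMillsFor r sch' T` (`sch' = sch` up to species renormalisations) and time-ordered `F`, the
truncated diagonal function `Φ_F(t) = 𝔖(ΘF̄ ⊗ T_tF) − |𝔖(F)|²` is a positive Laplace transform `∫e^{-tλ}dν_F` (OS
reconstruction of `T`); `T.HasMassGap Δ'` iff `ν_F([0,Δ')) = 0` for all `F`, and polarisation. `Φ_F(t) = lim_k Φ^k_F(t/a_k)`
along M-adic `t` (`ΘF̄ ⊗ T_tF` is off-diagonal). Lattice side: with Lüscher's positive transfer matrix for periodic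
time of ANY length the torus truncated diagonal correlator of `Φ − ⟨Φ⟩` is a POSITIVE combination of exponentials
`Σ p_i|a_ij|²(μ_j/μ_i)^m`, hence log-convex on `[0, 2L_k+1]`; `Φ^k(0) → Φ(0)` bounds the left end, `HasLatticeMassGap`
termwise bounds the antipodal value `Φ^k(L_k)`, and log-convexity interpolates `Φ(t) ≤ Φ(0)^{1−t/t₁}(…)^{t/t₁}e^{-Δt}`.
CAVEAT (recorded, not hidden): the termwise constants of `HasLatticeMassGap` do not see the `a_k⁸` smallness of
curvature-type covariances, so the antipodal bound carries the witness renormalisations `c_s(k)² ≲ Φ(0)/Var_latt`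
and the interpolation closes only when the physical volume `ℓ_k = a_k L_k` outgrows `log(1/a_k)`; for slower volumes
the tuning lower bound `⟨P;τ_{D_k}P⟩ ≈ θ a_k⁸` (available here) or UV-renormalised clustering must be brought in —
if neither suffices the repair is route-level (scheme regularity or moving the clause into (A)), not this line's.
Sources: OsterwalderSeiler1978 §§2–3, Luscher1977 (CMP 54), GlimmJaffe1987 §6.1 and §19, Seiler1982 Ch. 2,
OsterwalderSchrader1975, JaffeWitten2000 §5. -/
theorem stub_transfer :
    ∀ (G : Type) [Group G] [TopologicalSpace G] [IsTopologicalGroup G] [CompactSpace G]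
      [MeasurableSpace G] [BorelSpace G], IsCompactSimpleLieGroup G →
      ∀ (r : LatticeRep G) (M : ℕ) (θ : ℝ) (sch : SpeciesScheme (YMSpecies G)) (n : ℕ → ℕ),
        2 ≤ M → 0 < θ → (∀ k, sch.a k = ((M : ℝ) ^ n k)⁻¹) → Tendsto sch.β atTop atTop →
        Tendsto (fun k => ((M : ℝ) ^ n k) ^ 8 *
            latticeConnectedCorr r.ρ (sch.β k) (sch.side k) r.curvature.F r.curvature.F (M ^ n k))
          atTop (𝓝 θ) →
        ∀ Δ : ℝ, 0 < Δ → HasLatticeMassGap r sch Δ → ∃ Δ' : ℝ, 0 < Δ' ∧ TransferHalf r sch Δ' := by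
  sorry

/-! ## §4 Gluing the two halves at independent rates (Disproof §2, re-proved verbatim) -/

section Anti

variable {G : Type} [Group G] [TopologicalSpace G] [IsTopologicalGroup G] [CompactSpace G]
  [MeasurableSpace G] [BorelSpace G] {ι : Type}

/-- The lattice half is antitone in the rate (Disproof §2 `hasLatticeMassGap_anti`). -/
theorem hasLatticeMassGap_anti (r : LatticeRep G) (sch : SpeciesScheme ι) {Δ Δ' : ℝ}
    (hΔ' : Δ' ≤ Δ) (h : HasLatticeMassGap r sch Δ) : HasLatticeMassGap r sch Δ' := by
  intro A B
  obtain ⟨C, hC⟩ := h A B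
  refine ⟨max C 0, hC.mono fun k hk S hS n hn => (hk S hS n hn).trans ?_⟩
  have hx : 0 ≤ sch.a k * n := mul_nonneg (sch.a_pos k).le (Nat.cast_nonneg n)
  calc C * Real.exp (-(Δ * (sch.a k * n)))
      ≤ max C 0 * Real.exp (-(Δ * (sch.a k * n))) :=
        mul_le_mul_of_nonneg_right (le_max_left _ _) (Real.exp_pos _).le
    _ ≤ max C 0 * Real.exp (-(Δ' * (sch.a k * n))) :=
        mul_le_mul_of_nonneg_left (Real.exp_le_exp.2 (by nlinarith)) (le_max_right _ _)

end Anti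

/-! ## §5 The composition (kernel-checked; `sorry` only inside the five stubs it invokes) -/

/-- **The line closes the crux** (concludes `ParabolicTrajectory.LatticeGapOnTrajectory` BY NAME, no hypotheses).
Fix the crux's data and its Borel structure; the physics stub gives the orbit–Kantorovich windows along the scheme;
the smoothing stub, fed the engine and the DLR description, gives the lattice half at some `Δ₁ > 0`; the transfer
stub gives the transfer half at some `Δ₂ > 0`; both halves are antitone (`hasLatticeMassGap_anti`, registered glue
`transferHalf_anti`), so `Δ = min Δ₁ Δ₂` (Disproof §2 `concl_iff_split`: halves at independent rates). -/
theorem LatticeGapOnTrajectory_of : LatticeGapOnTrajectory := by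
  intro G _ _ _ _ hG r M θ sch n hM hθ hshape hβ htune
  letI : MeasurableSpace G := borel G
  haveI : BorelSpace G := ⟨rfl⟩
  have hW : OrbitKRWindowsAlong r M sch n :=
    stub_orbitKantorovichWindow G hG r M θ sch n hM hθ hshape hβ htune
  obtain ⟨Δ₁, hΔ₁, hlat⟩ :=
    stub_smoothingToGap G r M sch n hM hshape stub_krFiniteSizeDecay stub_torusFrames stub_specificationTower
      (stub_wilsonTorusDLR G r) hW
  obtain ⟨Δ₂, hΔ₂, htr⟩ := stub_transfer G hG r M θ sch n hM hθ hshape hβ htune Δ₁ hΔ₁ hlat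
  exact ⟨min Δ₁ Δ₂, lt_min hΔ₁ hΔ₂, hasLatticeMassGap_anti r sch (min_le_left _ _) hlat,
    transferHalf_anti G r sch Δ₂ (min Δ₁ Δ₂) (min_le_right _ _) htr⟩

end Summit.QuantumFields.YangMills.Cruxes.LatticeGapOnTrajectory.OrbitKantorovichFiniteSize

end
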